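import Summits.NavierStokesRegularity.FluidComputer.GateBudgetLadderBase
import HarnessLib

/-!
# What no tuning can beat, part 52: THE PULSE STEP, UNIVERSAL AND UN-ROUNDED — for ANY pulse
# `[r, T']` of a lattice member that enters with clock `≥ θ₁ε` at trigger `≤ ρ²/K⁹`, keeps a
# ring `b² + c² ≥ ν₂ε²` and leaves with clock `≤ -θ₂ε` at trigger `≤ λ₀ρ²`: the phase is `kπ ±
# δ`, `δ = kπ/(ν₂K¹⁰ - 1) + 1/K¹⁹`, and `√(d² + ã²)` steps by at most `δ + 1210/K⁸`

Cell `pub-fluidc`, blueprint seat bp1 (gen 34, third item); same namespace and conventions as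
parts 1–51 (`GateBudget*.lean`); imports part 51 (`GateBudgetLadderBase`) and through it part
48 (`lattice_pin_le`, `pair_sqrt_step`), part 41 (`pin_of_bracket`), part 37
(`refire_window_facts`), part 16 (`knob_swing_lower`, `knob_phase_bracket`), part 14
(`knob_phase_tracking_d`), part 1/4 (`e_nonneg`, `traj_abs_le_one`). Headline amplifier `M =
K¹⁰`, `K ≥ 16`, `ε² ≤ 1/(6K²⁰)`, `K¹⁰ρ² ≤ 2ε`; modes `0 = a` carrier, `1 = b` clock, `2 = c`
trigger, `3 = d` transfer, `4 = ã` output of `rotorCircuit K K¹⁰ ε ρ` from (5.6); `λ₀ = K⁻¹⁰ +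
4e^{-K¹⁰}/K¹⁰`; `P = d² + ã²`. HONEST FRAMING (verbatim): low prior, high value-of-information
experiment on Tao's machine paradigm; NOT a claim that NS blows up. Nothing is proved about
the Navier–Stokes equations.

THE POINT (SPEC-INPUT-bp1 §AV successors (20′c′) THE DRIFT UN-ROUNDED and the pulse half of
(20′d) THE LADDER THEOREM). Part 49's §145 proved the sharp pin and the ladder step for the
SECOND pulse of a lattice dud, on part 46's ∃-tuple and with part 14's drift `968/K⁸` ROUNDED to
`10⁻⁶` at `K = 16` — an additive `1.1·10⁻⁶` per pulse that does not decay in `K` and caps the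
misfire ladder near the top of the window at `≈ 10⁵` rungs for every `K`. The induction over
pulses needs the same step (i) for an ARBITRARY pulse, stated over hypotheses a generic rung
can supply, and (ii) with the drift kept as `O(K⁻⁸)`:
* §153 `kept_ring`: a pulse entering with clock `b(r) ≥ θ₁ε` (`θ₁ ≥ 0`) whose clock-pair radius
  is kept to `ε²/10⁶` (part 45's law) has the ring `b² + c² ≥ (θ₁² - 10⁻⁶)ε²` throughout.
* §154 `knob_pulse_step`: `K ≥ 16`, `0 < ε`, `ε² ≤ 1/(6K²⁰)`, `K¹⁰ρ² ≤ 2ε`, the lattice `ε =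
  kK¹⁰ρ²`, ANY `0 ≤ r ≤ T'` with `T' - r ≤ 242/K⁹`, ratios `θ₁ ≥ 5/4`, `θ₂ ≥ 1`, `ν₂ ≥ 1`, and on
  the pulse: `c > 0` on `[r, T']`, `c(r) ≤ ρ²/K⁹`, `b(r) ≥ θ₁ε`, `b(T') ≤ -θ₂ε`, `c(T') ≤ λ₀ρ²`,
  the ring `b² + c² ≥ ν₂ε²` on `[r, T']`, and the output growth `ã(T') ≤ ã(r) + K(T' - r)`. THEN,
  with `δ := kπ/(ν₂K¹⁰ - 1) + 1/K¹⁹`: `|(C(T') - C(r))/ρ² - kπ| ≤ δ` (part 16's swing and bracket,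
  part 41's pin, part 48's lattice pin — §145's argument with the numbers replaced by `θ₁, θ₂,
  ν₂`); `|d(T')| ≤ δ|a(r)| + |d(r)| + 968/K⁸` (part 14's tracking, drift `2(ε + σ + Kã)(T' - r) ≤
  4K·242/K⁹`, NOT rounded); `0 ≤ ã(T') ≤ ã(r) + 242/K⁸`; `√P(T') ≤ √P(r) + δ + 1210/K⁸` (part
  48's pair step).
* §155 `pulse_slip_uniform`: on the index window `200k ≤ K¹⁰` and for rings `ν₂ ≥ 8/5` (entry
  clock `≥ 1.265ε`, part 47's re-arming floor, kept to `10⁻⁶ε²`): `δ ≤ 0.00982`.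
* §156 `knob_dud_second_step_fine`: the second pulse (part 46's tuple) IS an instance — every
  hypothesis of §154 discharged with `θ₁ = 1.394`, `θ₂ = 1.3939`, `ν₂ = 1.394² - 10⁻⁶` — so its
  ladder step holds with `1210/K⁸` in place of part 49's rounded `11/10⁷` ((20′c′) done).

READING. With §154 the per-pulse increment of `√(d² + ã²)` along the misfire ladder is `δ_k(ν₂)
+ 1210/K⁸ + dose`, ALL of it either member-wise small (`δ ∝ k/K¹⁰`) or decaying in `K`: for the
top of the window (`k = 1`) the step is `≈ π/(ν₂K¹⁰) + 1210/K⁸ + 3/K⁹ ≍ K⁻⁸`, so the number of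
certified misfires before part 47's re-arming budget `√(1/60)` is spent is `≍ 0.09·K⁸/1210 ≍ K⁸`
(`≈ 3·10⁵` at `K = 16`) instead of part 51's floor-limited `≈ 10⁵` for every `K` — the sharp
form of STATIONARITY (SPEC (20′)): a detuned member with `k = 1` does not fire before time `≍
2.85·K⁸/1210`. What remains for the induction (20′d) is the OTHER half of a rung — the cold
window, re-arming and re-ignition laws of parts 39/45/47 free of their horizon caps (20′b),
which supply exactly §154's hypotheses at the next pulse (`θ₁ = 1.265`, `ν₂ = 8/5` by §153,
`θ₂` and `λ₀` from the dousing law).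
HONEST LIMITS. (i) Upper side only; (ii) the hypotheses of §154 are discharged in the tree only
for the second pulse (§156) — for pulse `n ≥ 3` they wait for (20′b); (iii) `968/K⁸` uses `|ã| ≤
1` and `242/K⁸` uses `d² ≤ 1` (part 43's growth law) — both could be lowered by the smallness of
`P` along the ladder, not done; (iv) lattice members only, `M = K¹⁰`, `K ≥ 16`; (v) nothing
about Navier–Stokes.
[cite: Tao2016AveragedNS, §5.5 Theorem 5.3, (5.5), (5.6), (b-eq), (c-eq), (dora), (tcable),
(energy-con)]
-/

noncomputable section

namespace Summit.NavierStokesRegularity.FluidComputer.GateBudget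

open Real Set Filter Topology
open Literature.Analysis.FluidPDE.Tao2016AveragedNS

variable {K ε ρ : ℝ} {X : ℝ → Fin 5 → ℝ} {C : ℝ → ℝ}

/-! ## §153 A kept radius is a ring -/

/-- **A KEPT RADIUS IS A RING.** If `b(r) ≥ θ₁ε` with `θ₁, ε ≥ 0` and the clock-pair radius is kept,
`|b² + c² - (b(r)² + c(r)²)| ≤ ε²/10⁶` on `[r, T']` (part 45's law), then `b² + c² ≥ (θ₁² -
10⁻⁶)ε²` on `[r, T']` — the ring hypothesis of §154 with `ν₂ = θ₁² - 10⁻⁶`.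
[cite: Tao2016AveragedNS, §5.5 (5.5), (b-eq), (c-eq)] -/
theorem kept_ring {r T' θ₁ : ℝ} (hε : 0 ≤ ε) (hθ₁ : 0 ≤ θ₁) (hbr : θ₁ * ε ≤ X r 1)
    (hkept : ∀ t ∈ Icc r T', |X t 1 ^ 2 + X t 2 ^ 2 - (X r 1 ^ 2 + X r 2 ^ 2)| ≤ ε ^ 2 / 10 ^ 6) :
    ∀ t ∈ Icc r T', (θ₁ ^ 2 - 1 / 10 ^ 6) * ε ^ 2 ≤ X t 1 ^ 2 + X t 2 ^ 2 := by
  intro t ht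
  have h := (abs_le.1 (hkept t ht)).1
  have hb2 : (θ₁ * ε) ^ 2 ≤ X r 1 ^ 2 := pow_le_pow_left₀ (mul_nonneg hθ₁ hε) hbr 2
  nlinarith only [h, hb2, sq_nonneg (X r 2)]

/-! ## §154 The pulse step, universal and un-rounded -/

/-- **THE PULSE STEP, UNIVERSAL AND UN-ROUNDED.** `K ≥ 16`, `0 < ε`, `ε² ≤ 1/(6K²⁰)`, `0 < ρ`,
`K¹⁰ρ² ≤ 2ε`, an exact trajectory of `rotorCircuit K K¹⁰ ε ρ` from (5.6) ON THE LATTICE `ε =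
kK¹⁰ρ²`, `C` any primitive of the trigger; ANY pulse `0 ≤ r ≤ T'`, `T' - r ≤ 242/K⁹` with ratios
`θ₁ ≥ 5/4`, `θ₂ ≥ 1`, `ν₂ ≥ 1` such that `c > 0` on `[r, T']`, `c(r) ≤ ρ²/K⁹`, `b(r) ≥ θ₁ε`,
`b(T') ≤ -θ₂ε`, `c(T') ≤ λ₀ρ²`, `b² + c² ≥ ν₂ε²` on `[r, T']`, `ã(T') ≤ ã(r) + K(T' - r)`. With `δ =
kπ/(ν₂K¹⁰ - 1) + 1/K¹⁹`: `|(C(T') - C(r))/ρ² - kπ| ≤ δ`; `|d(T')| ≤ δ|a(r)| + |d(r)| + 968/K⁸`;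
`0 ≤ ã(T') ≤ ã(r) + 242/K⁸`; `√(d² + ã²)(T') ≤ √(d² + ã²)(r) + δ + 1210/K⁸`. (§145's argument for
a generic pulse: part 16's swing `≥ π - arctan(ρ²/K⁹/(θ₁ε)) - arctan(λ₀ρ²/(θ₂ε))` and bracket on
the ring `√ν₂·ε`, winding `ε/(K¹⁰ρ²) = k`, part 41's `pin_of_bracket`, part 48's `lattice_pin_le`
at `ν = √ν₂`; part 14's tracking with the drift `2(ε + σ + Kã(T'))(T' - r) ≤ 968/K⁸` kept as it
is; part 48's `pair_sqrt_step`.)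
[cite: Tao2016AveragedNS, §5.5 Theorem 5.3, (5.5), (5.6), (b-eq), (c-eq), (dora), (tcable)] -/
theorem knob_pulse_step
    (hX : ∀ t, HasDerivAt X (RotorKnob.rotorCircuit K (K ^ 10) ε ρ (X t)) t)
    (h0 : X 0 = delayInit) (hC : ∀ t, HasDerivAt C (X t 2) t) (hK : 16 ≤ K) (hε : 0 < ε)
    (hεK : ε ^ 2 ≤ 1 / (6 * K ^ 20)) (hρ : 0 < ρ) (hhi : K ^ 10 * ρ ^ 2 ≤ 2 * ε) (k : ℕ)
    (hk : ε = k * K ^ 10 * ρ ^ 2) {r T' θ₁ θ₂ ν₂ : ℝ} (hr0 : 0 ≤ r) (hrT : r ≤ T')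
    (hτ : T' - r ≤ 242 / K ^ 9) (hθ₁ : 5 / 4 ≤ θ₁) (hθ₂ : 1 ≤ θ₂) (hν₂ : 1 ≤ ν₂)
    (hc : ∀ t ∈ Icc r T', 0 < X t 2) (hcr : X r 2 ≤ ρ ^ 2 / K ^ 9) (hbr : θ₁ * ε ≤ X r 1)
    (hbT : X T' 1 ≤ -(θ₂ * ε))
    (hcT : X T' 2 ≤ (1 / K ^ 10 + 4 * exp (-K ^ 10) / K ^ 10) * ρ ^ 2)
    (hring : ∀ t ∈ Icc r T', ν₂ * ε ^ 2 ≤ X t 1 ^ 2 + X t 2 ^ 2)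
    (hgrow : X T' 4 ≤ X r 4 + K * (T' - r)) :
    |(C T' - C r) / ρ ^ 2 - k * π| ≤ k * π / (ν₂ * K ^ 10 - 1) + 1 / K ^ 19 ∧
      |X T' 3| ≤ (k * π / (ν₂ * K ^ 10 - 1) + 1 / K ^ 19) * |X r 0| + |X r 3| + 968 / K ^ 8 ∧
      0 ≤ X T' 4 ∧ X T' 4 ≤ X r 4 + 242 / K ^ 8 ∧
      √(X T' 3 ^ 2 + X T' 4 ^ 2) ≤ √(X r 3 ^ 2 + X r 4 ^ 2)
        + (k * π / (ν₂ * K ^ 10 - 1) + 1 / K ^ 19) + 1210 / K ^ 8 := by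
  have hK0 : 0 < K := by linarith
  have hK10 : 0 < K ^ 10 := by positivity
  have hε2 : 0 < ε ^ 2 := by positivity
  have h8 : (4294967296 : ℝ) ≤ K ^ 8 := by
    have := headline_pow_floor hK 8; norm_num at this; exact this
  have h10 : (1099511627776 : ℝ) ≤ K ^ 10 := by
    have := headline_pow_floor hK 10; norm_num at this; exact this
  obtain ⟨hq1, -, -, -, -, -, -, hε1, -, -, hσ, -, -⟩ := refire_window_facts hK hε hεK hhi
  have hXf := hX
  rw [RotorKnob.rotorCircuit_eq_fiveGate] at hXf
  have hτ0 : 0 ≤ T' - r := by linarith only [hrT]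
  have hcr0 : 0 < X r 2 := hc r ⟨le_rfl, hrT⟩
  have hcT0 : 0 < X T' 2 := hc T' ⟨hrT, le_rfl⟩
  have hk0 : (0 : ℝ) ≤ k := Nat.cast_nonneg k
  have hθ₁0 : 0 < θ₁ := by linarith only [hθ₁]
  have hθ₂0 : 0 < θ₂ := by linarith only [hθ₂]
  have hν0 : 0 ≤ ν₂ := by linarith only [hν₂]
  have hsν : 0 < √ν₂ := Real.sqrt_pos.2 (by linarith only [hν₂])
  have hνsq : √ν₂ ^ 2 = ν₂ := Real.sq_sqrt hν0
  have hν1 : 1 ≤ √ν₂ := by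
    rw [show (1 : ℝ) = √1 from Real.sqrt_one.symm]
    exact Real.sqrt_le_sqrt hν₂
  -- the swing from `r`: `b₁ = θ₁ε`, `γ₁ = ρ²/K⁹`, `β = θ₂ε`, `λ₀`
  have hη := knob_swing_lower (X := X) (ρ := ρ) (b₁ := θ₁ * ε) (γ₁ := ρ ^ 2 / K ^ 9)
    (β := θ₂ * ε) (lam₀ := 1 / K ^ 10 + 4 * exp (-K ^ 10) / K ^ 10)
    (mul_pos hθ₁0 hε) hbr hcr0 hcr (mul_pos hθ₂0 hε) hbT hcT0 hcT
  -- the ring `(√ν₂·ε)²` and the critical ratio `q = 1/(ν₂K¹⁰) < 1`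
  have hring' : ∀ t ∈ Icc r T', (√ν₂ * ε) ^ 2 ≤ X t 1 ^ 2 + X t 2 ^ 2 := by
    intro t ht
    rw [mul_pow, hνsq]
    exact hring t ht
  have hq : ε ^ 2 < K ^ 10 * (√ν₂ * ε) ^ 2 := by
    rw [mul_pow, hνsq]
    have h1 : K ^ 10 * (1 * ε ^ 2) ≤ K ^ 10 * (ν₂ * ε ^ 2) :=
      mul_le_mul_of_nonneg_left (mul_le_mul_of_nonneg_right hν₂ hε2.le) hK10.le
    nlinarith only [h1, h10, hε2]
  obtain ⟨hlo', hhi'⟩ := knob_phase_bracket hX h0 hε hρ hK10 hC hrT (mul_pos hsν hε) hq hc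
    hring' hη
  have hw : ε / (K ^ 10 * ρ ^ 2) = k := by
    rw [div_eq_iff (by positivity), hk]; ring
  rw [hw] at hlo' hhi'
  have hηpos : 0 ≤ arctan (ρ ^ 2 / K ^ 9 / (θ₁ * ε))
      + arctan ((1 / K ^ 10 + 4 * exp (-K ^ 10) / K ^ 10) * ρ ^ 2 / (θ₂ * ε)) :=
    add_nonneg (Real.arctan_nonneg.2 (by positivity)) (Real.arctan_nonneg.2 (by positivity))
  have hq0 : 0 ≤ ε ^ 2 / (K ^ 10 * (√ν₂ * ε) ^ 2) := div_nonneg hε2.le (hε2.trans hq).le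
  have hq1' : ε ^ 2 / (K ^ 10 * (√ν₂ * ε) ^ 2) < 1 := (div_lt_one (hε2.trans hq)).2 hq
  have hpin := pin_of_bracket hk0 hηpos (by positivity) hq0 hq1' hlo' hhi'
  -- part 48 §142 at `θ₁`, `θ₂`, `ν = √ν₂`
  have hψ := lattice_pin_le (K := K) (ε := ε) (ρ := ρ) (τ := T' - r) (θ₁ := θ₁) (θ₂ := θ₂)
    (ν := √ν₂) k hk hε hρ hK hτ0 hτ hθ₁ hθ₂ hν1
  rw [hνsq] at hψ
  set δ := k * π / (ν₂ * K ^ 10 - 1) + 1 / K ^ 19 with hδ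
  have hpinS : |(C T' - C r) / ρ ^ 2 - k * π| ≤ δ := hpin.trans hψ
  have hden : 0 < ν₂ * K ^ 10 - 1 := by nlinarith only [h10, hν₂]
  have hδ0 : 0 ≤ δ := by positivity
  -- part 14's tracking of the transfer mode from `r`; drift `≤ 968/K⁸`, NOT rounded
  have htd := knob_phase_tracking_d hX h0 hC hε.le hK0.le hr0 hrT
  set Φ := (C T' - C r) / ρ ^ 2 with hΦ
  have heT0 : 0 ≤ X T' 4 := e_nonneg hXf h0 hK0.le (hr0.trans hrT)
  have heT1 : X T' 4 ≤ 1 := (le_abs_self _).trans (traj_abs_le_one hXf h0 T' 4)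
  have hL : ε + ρ ^ 2 * exp (-K ^ 10) + K * X T' 4 ≤ 2 * K := by
    have h1 : K * X T' 4 ≤ K * 1 := mul_le_mul_of_nonneg_left heT1 hK0.le
    have h2 : ρ ^ 2 * exp (-K ^ 10) ≤ 1 := by
      have : ε * (1 / K ^ 10) ≤ 1 * 1 :=
        mul_le_mul hε1 (by linarith only [hq1]) (by positivity) zero_le_one
      linarith only [hσ, this]
    linarith only [h1, h2, hε1, hK]
  have hdrift : 2 * ((ε + ρ ^ 2 * exp (-K ^ 10) + K * X T' 4) * (T' - r)) ≤ 968 / K ^ 8 := by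
    have h1 : (ε + ρ ^ 2 * exp (-K ^ 10) + K * X T' 4) * (T' - r) ≤ 2 * K * (242 / K ^ 9) :=
      mul_le_mul hL hτ hτ0 (by positivity)
    have h2 : 2 * K * (242 / K ^ 9) = 484 / K ^ 8 := by
      field_simp
      norm_num
    linarith only [h1, h2, show (968 : ℝ) / K ^ 8 = 2 * (484 / K ^ 8) by ring]
  -- `|sin Φ| ≤ |Φ - kπ| ≤ δ`, `|cos Φ| ≤ 1`
  have hsin : |sin Φ| ≤ δ := by
    have hΘ : Φ = (Φ - k * π) + k * π := by ring
    rw [hΘ, sin_add_nat_mul_pi, abs_mul, abs_pow, abs_neg, abs_one, one_pow, one_mul]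
    exact abs_sin_le_abs.trans hpinS
  have hd2 : |X T' 3| ≤ δ * |X r 0| + |X r 3| + 968 / K ^ 8 := by
    have h1 := abs_sub_abs_le_abs_sub (X T' 3) (sin Φ * X r 0 + cos Φ * X r 3)
    have h2 := abs_add_le (sin Φ * X r 0) (cos Φ * X r 3)
    rw [abs_mul, abs_mul] at h2
    have h3 : |sin Φ| * |X r 0| ≤ δ * |X r 0| :=
      mul_le_mul_of_nonneg_right hsin (abs_nonneg _)
    have h4 : |cos Φ| * |X r 3| ≤ |X r 3| :=
      mul_le_of_le_one_left (abs_nonneg _) (abs_cos_le_one _)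
    linarith only [h1, h2, h3, h4, htd, hdrift]
  -- the output: `ã(T') ≤ ã(r) + 242/K⁸`
  have heT : X T' 4 ≤ X r 4 + 242 / K ^ 8 := by
    have h1 : K * (T' - r) ≤ K * (242 / K ^ 9) := mul_le_mul_of_nonneg_left hτ hK0.le
    have h2 : K * (242 / K ^ 9) = 242 / K ^ 8 := by
      field_simp
    linarith only [hgrow, h1, h2]
  -- the ladder step (part 48 §144): `x = δ + 968/K⁸`, `y = 242/K⁸`
  have ha10 : |X r 0| ≤ 1 := traj_abs_le_one hXf h0 r 0
  have hd2' : |X T' 3| ≤ |X r 3| + (δ + 968 / K ^ 8) := by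
    have : δ * |X r 0| ≤ δ := mul_le_of_le_one_right hδ0 ha10
    linarith only [hd2, this]
  have hstep := pair_sqrt_step hd2' heT0 heT (by positivity) (by positivity)
  exact ⟨hpinS, hd2, heT0, heT, by
    linarith only [hstep, show (1210 : ℝ) / K ^ 8 = 968 / K ^ 8 + 242 / K ^ 8 by ring]⟩

/-! ## §155 The pulse slip, uniformly on the index window -/

/-- **The pulse slip, uniformly.** On the index window `200k ≤ K¹⁰` (part 48 §143), `K ≥ 16`,
and for any ring ratio `ν₂ ≥ 8/5` (entry clock `≥ 1.265ε` — part 47's re-arming floor — kept to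
`10⁻⁶ε²`, §153): `kπ/(ν₂K¹⁰ - 1) + 1/K¹⁹ ≤ 0.00982` (`π < 3.1416`, `K¹⁰ ≥ 2⁴⁰`; the value is
`π/320 + O(2⁻⁴⁰)`). For part 49's second pulse (`ν₂ = 1.943`) the bound was `0.0081`.
[cite: Tao2016AveragedNS, §5.5 Theorem 5.3, (tcable)] -/
theorem pulse_slip_uniform {K k ν₂ : ℝ} (hK : 16 ≤ K) (hk0 : 0 ≤ k) (hk : 200 * k ≤ K ^ 10)
    (hν₂ : 8 / 5 ≤ ν₂) : k * π / (ν₂ * K ^ 10 - 1) + 1 / K ^ 19 ≤ 982 / 100000 := by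
  have hK0 : 0 < K := by linarith
  have h10 : (1099511627776 : ℝ) ≤ K ^ 10 := by
    have := headline_pow_floor hK 10; norm_num at this; exact this
  have hνK : 8 / 5 * K ^ 10 ≤ ν₂ * K ^ 10 := mul_le_mul_of_nonneg_right hν₂ (by positivity)
  have hden : 0 < ν₂ * K ^ 10 - 1 := by nlinarith only [h10, hνK]
  have hπ : π ≤ 31416 / 10000 := by
    have := Real.pi_lt_d4; norm_num at this ⊢; linarith
  have hA : k * π / (ν₂ * K ^ 10 - 1) ≤ 98176 / 10000000 := by
    rw [div_le_iff₀ hden]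
    have hkπ : k * π ≤ k * (31416 / 10000) := mul_le_mul_of_nonneg_left hπ hk0
    nlinarith only [hkπ, hk, h10, hk0, hνK]
  have h19 : (1 : ℝ) / K ^ 19 ≤ 1 / 10000000 := by
    have : (16 : ℝ) ^ 19 ≤ K ^ 19 := headline_pow_floor hK 19
    exact one_div_le_one_div_of_le (by norm_num) (by linarith only [this])
  linarith only [hA, h19]

/-! ## §156 The second pulse is an instance: its step with the drift un-rounded -/

/-- **The second pulse is an instance of §154.** For a lattice member (`K ≥ 16`, `0 < ε`, `ε² ≤
1/(6K²⁰)`, `200ε/K²⁰ ≤ ρ²`, `K¹⁰ρ² ≤ 2ε`, `ε = kK¹⁰ρ²`) part 46's master tuple of the second pulse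
`[r₁, T₂]` meets every hypothesis of §154 with `θ₁ = 1.394`, `θ₂ = 1.3939` and, by §153 on part
45's kept radius, the ring `ν₂ = (1.394)² - 10⁻⁶`; hence, with `δ' = kπ/(ν₂K¹⁰ - 1) + 1/K¹⁹`
(finer than part 49's `δ_k`, ring `(1.3939)²`): `|(C(T₂) - C(r₁))/ρ² - kπ| ≤ δ'`, `|d(T₂)| ≤
δ'|a(r₁)| + |d(r₁)| + 968/K⁸`, `ã(T₂) ≤ ã(r₁) + 242/K⁸` and the UN-ROUNDED ladder step `√(d² +
ã²)(T₂) ≤ √(d² + ã²)(r₁) + δ' + 1210/K⁸` — SPEC (20′c′): part 49's additive `11/10⁷` replaced by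
`1210/K⁸` (`2.8·10⁻⁷` at `K = 16`, decaying).
[cite: Tao2016AveragedNS, §5.5 Theorem 5.3, (5.5), (5.6), (b-eq), (c-eq), (tcable)] -/
theorem knob_dud_second_step_fine
    (hX : ∀ t, HasDerivAt X (RotorKnob.rotorCircuit K (K ^ 10) ε ρ (X t)) t)
    (h0 : X 0 = delayInit) (hC : ∀ t, HasDerivAt C (X t 2) t) (hK : 16 ≤ K) (hε : 0 < ε)
    (hεK : ε ^ 2 ≤ 1 / (6 * K ^ 20)) (hρ : 0 < ρ) (hlo : 200 * ε / K ^ 20 ≤ ρ ^ 2)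
    (hhi : K ^ 10 * ρ ^ 2 ≤ 2 * ε) (k : ℕ) (hk : ε = k * K ^ 10 * ρ ^ 2) :
    ∃ T tz r₁ T₂ : ℝ, √(2 - 24 * Real.log K / K ^ 10) ≤ T ∧ T ≤ √(2 + 2 / K ^ 10) + 242 / K ^ 9 ∧
      T + 1414213 / 1000000 ≤ tz ∧ tz ≤ T + 14242 / 10000 ∧ T + 28282 / 10000 < r₁ ∧
      r₁ < T + 28542 / 10000 ∧ r₁ < T₂ ∧ T₂ - r₁ ≤ 242 / K ^ 9 ∧
      |(C T₂ - C r₁) / ρ ^ 2 - k * π|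
        ≤ k * π / (((1394 / 1000) ^ 2 - 1 / 10 ^ 6) * K ^ 10 - 1) + 1 / K ^ 19 ∧
      |X T₂ 3| ≤ (k * π / (((1394 / 1000) ^ 2 - 1 / 10 ^ 6) * K ^ 10 - 1) + 1 / K ^ 19)
        * |X r₁ 0| + |X r₁ 3| + 968 / K ^ 8 ∧
      X T₂ 4 ≤ X r₁ 4 + 242 / K ^ 8 ∧
      √(X T₂ 3 ^ 2 + X T₂ 4 ^ 2) ≤ √(X r₁ 3 ^ 2 + X r₁ 4 ^ 2)
        + (k * π / (((1394 / 1000) ^ 2 - 1 / 10 ^ 6) * K ^ 10 - 1) + 1 / K ^ 19)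
        + 1210 / K ^ 8 := by
  -- part 46's master tuple: groups (a) part 41, (b) part 43, (c) part 45, (d) part 46
  obtain ⟨T, tz, r₁, T₂, ⟨hr1, -, hsT, hτ, hc, -, -, hcr₁, -, hcT, -, hgrow⟩,
      ⟨hT1, hT2, -, -, htz1, htz2, -, -, hTr1, hTr2, -⟩, hb1394, -, hkept, -, hbT₂u, -, -⟩ :=
    knob_dud_second_misfire hX h0 hC hK hε hεK hρ hlo hhi k hk
  have hr₁0 : 0 ≤ r₁ := by linarith [Real.sqrt_nonneg (2 - 24 * Real.log K / K ^ 10)]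
  -- §153: the kept radius is the ring `(1.394² - 10⁻⁶)ε²`; then §154
  have hring := kept_ring (X := X) hε.le (by norm_num) hb1394 hkept
  obtain ⟨h1, h2, -, h3, h4⟩ := knob_pulse_step hX h0 hC hK hε hεK hρ hhi k hk hr₁0 hsT.le hτ
    (by norm_num) (by norm_num) (by norm_num) hc hcr₁.le hb1394 hbT₂u hcT hring hgrow
  exact ⟨T, tz, r₁, T₂, hT1, hT2, htz1, htz2, hTr1, hTr2, hsT, hτ, h1, h2, h3, h4⟩

end Summit.NavierStokesRegularity.FluidComputer.GateBudget
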